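import Summits.AtomisticToContinuum.Crystallization.Theorems.ThreeConeCertificateSlackRigidityPricedFloorsDefs
import Summits.AtomisticToContinuum.Crystallization.Theorems.PhononSlackCertificatesPeriodicGivenLayeredLayerCake
import Summits.AtomisticToContinuum.Crystallization.Theorems.PhononSlackCertificatesPeriodicGivenLayeredClosing2
import Summits.AtomisticToContinuum.Crystallization.Theorems.PhononSlackCertificatesPeriodicGivenLayeredRegistry
import Summits.AtomisticToContinuum.Crystallization.Theorems.PhononSlackCertificatesPeriodicGivenLayeredExtraction1
import Summits.AtomisticToContinuum.Crystallization.Theorems.PalmUnimodularRigidityMinimiserShellsEnergyFloorC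
import HarnessLib

/-!
# `SlackRigidity` (stmt-AtomisticToContinuum-11960), line `priced-floors-palm-exactification`, stub S3
# (`stub_layeredMeanSelection`): the root energy of an exactly layered sample, layer by layer

Lead c19, S3 energetics, part 1 (deterministic).  For a rooted configuration whose atoms form a
GLOBALLY exactly layered set (`GlobalLayered`, the output of S2):

* `exists_normalForm` — normal form: the atoms are `layeredSet A a s z` with ADMISSIBLE data and
  `z 0 = 0`, the root being the pattern point of indices `(0,0,0)` (the translation of `GlobalLayered`
  is absorbed by re-indexing the layers and the in-plane lattice);
* `two_mul_rootEnergy_eq` — ROOT LAYER CAKE: `2·h(count|layeredSet A a s z) = Φ₀(a) + Σ'_{m ≠ 0}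
  Φ(z m, L m)` (`LayeredHull.cake_siteEnergy` at the root + the Bochner integral against a counting
  measure as a `tsum`);
* `fault_price_root` — FAULT PRICE AT THE ROOT (per site!): with the certified registry constant
  `c₀ > 0` of `LayeredHull.stub_registry`,
  `c₀·1[s 1 ≠ −s 0] ≤ 2·h(count|layeredSet A a s z) − 2·h(count|layeredSet A a alternatingHagg z)`
  (`LayeredHull.clo_layer_price` at layer `0`): restacking the word to the alternating one at the SAME
  heights lowers the root energy by at least `c₀` whenever the root layer is a stacking fault.

All `[folklore]` bookkeeping over landed lemmas; registered sub-goal `lms_fault_price_root`.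
-/

noncomputable section

open MeasureTheory Filter Set
open scoped ENNReal BigOperators Topology

namespace Summit.AtomisticToContinuum.Crystallization.Theorems.SlackRigidityPricedFloorsRootCake

open Literature.Probability.Process
open Literature.MathematicalPhysics.StatisticalMechanics
open Summit.AtomisticToContinuum.Crystallization.Theorems.SlackRigidityPricedFloors
open Summit.AtomisticToContinuum.Crystallization.Theorems.LayeredHull
open Summit.AtomisticToContinuum.Crystallization.Theorems.PalmUnimodularRigidityMinimiserShells.EnergyFloor
  (integrable_of_lintegral_ofReal_ne_top lintegral_pos_ne_top_of_hc lintegral_neg_le_of_hc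
    measurable_lennardJones)

/-! ## Normal form of a rooted globally layered configuration -/

/-- Re-indexing the layers of a layered set by `m₀` and its in-plane lattice by `(i₀, j₀)` is the
translation by the pattern point of indices `(m₀, i₀, j₀)`. [folklore] -/
theorem layeredSet_reindex (A : E3 →ₗᵢ[ℝ] E3) (a : ℝ) (s : ℤ → ℤ) (z : ℤ → ℝ) (m₀ i₀ j₀ : ℤ) :
    layeredSet A a (fun k => s (k + m₀)) (fun k => z (k + m₀) - z m₀) =
      (fun x => x - A (((i₀ : ℝ) • triangularVec₁ a) + ((j₀ : ℝ) • triangularVec₂ a) +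
        ((haggLabel s m₀ : ℝ) • barlowOffset a) + (z m₀ • layerNormal 1))) '' layeredSet A a s z := by
  ext x
  simp only [layeredSet, mem_setOf_eq, mem_image]
  constructor
  · rintro ⟨k, i, j, rfl⟩
    refine ⟨A ((((i + i₀ : ℤ) : ℝ) • triangularVec₁ a) + (((j + j₀ : ℤ) : ℝ) • triangularVec₂ a) +
      ((haggLabel s (k + m₀) : ℝ) • barlowOffset a) + (z (k + m₀) • layerNormal 1)),
      ⟨k + m₀, i + i₀, j + j₀, rfl⟩, ?_⟩
    rw [← A.map_sub, ext_haggLabel_shift]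
    congr 1
    push_cast
    module
  · rintro ⟨_, ⟨m, i, j, rfl⟩, rfl⟩
    refine ⟨m - m₀, i - i₀, j - j₀, ?_⟩
    rw [← A.map_sub, ext_haggLabel_shift, sub_add_cancel]
    congr 1
    push_cast
    module

/-- **Normal form.** A rooted configuration whose atoms are globally exactly layered is, WITHOUT
translation, an admissible layered set with `z 0 = 0` (so the root is the pattern point `(0,0,0)`).
[folklore] -/
theorem exists_normalForm {S : Set E3} (hS : GlobalLayered S) (h0 : (0 : E3) ∈ S) :
    ∃ (A : E3 →ₗᵢ[ℝ] E3) (a : ℝ) (s : ℤ → ℤ) (z : ℤ → ℝ),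
      IsAdmissibleLayering a s z ∧ z 0 = 0 ∧ S = layeredSet A a s z := by
  obtain ⟨A, t, a, s, z, hadm, hSt⟩ := hS
  have ht : t ∈ layeredSet A a s z := by
    rw [← hSt]
    exact ⟨0, h0, zero_add t⟩
  obtain ⟨m₀, i₀, j₀, ht⟩ := ht
  refine ⟨A, a, fun k => s (k + m₀), fun k => z (k + m₀) - z m₀, ?_, by simp, ?_⟩
  · obtain ⟨ha, ha1, hs, hz⟩ := hadm
    refine ⟨ha, ha1, fun k => hs (k + m₀), fun k => ?_⟩
    have := hz (k + m₀)
    rw [show k + m₀ + 1 = k + 1 + m₀ by ring] at this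
    constructor <;> linarith [this.1, this.2]
  · rw [layeredSet_reindex, ← ht, ← hSt, Set.image_image]
    simp

/-! ## The root energy as a layer cake -/

/-- The layered set is the range of its (countable) parametrisation. [folklore] -/
theorem layeredSet_countable (A : E3 →ₗᵢ[ℝ] E3) (a : ℝ) (s : ℤ → ℤ) (z : ℤ → ℝ) :
    (layeredSet A a s z).Countable := by
  have h : layeredSet A a s z = Set.range (fun t : ℤ × ℤ × ℤ => A (((t.2.1 : ℝ) • triangularVec₁ a) +
      ((t.2.2 : ℝ) • triangularVec₂ a) + ((haggLabel s t.1 : ℝ) • barlowOffset a) +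
      (z t.1 • layerNormal 1))) := by
    ext p
    simp only [layeredSet, mem_setOf_eq, mem_range]
    constructor
    · rintro ⟨m, i, j, rfl⟩; exact ⟨(m, i, j), rfl⟩
    · rintro ⟨⟨m, i, j⟩, rfl⟩; exact ⟨m, i, j, rfl⟩
  rw [h]
  exact Set.countable_range _

/-- The root `0` is the pattern point `(0,0,0)` when `z 0 = 0`. [folklore] -/
theorem zero_mem_layeredSet (A : E3 →ₗᵢ[ℝ] E3) (a : ℝ) (s : ℤ → ℤ) {z : ℤ → ℝ} (hz0 : z 0 = 0) :
    (0 : E3) ∈ layeredSet A a s z :=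
  ⟨0, 0, 0, by simp [hz0]⟩

/-- An admissible layered set with `z 0 = 0` is `1/2`-separated and contains the root, so its counting
measure is a rooted `1/2`-hard-core configuration. [folklore] -/
theorem isRootedHardCore_layeredSet {A : E3 →ₗᵢ[ℝ] E3} {a : ℝ} {s : ℤ → ℤ} {z : ℤ → ℝ}
    (hadm : IsAdmissibleLayering a s z) (hz0 : z 0 = 0) :
    IsRootedHardCore (1 / 2) ((Measure.count : Measure E3).restrict (layeredSet A a s z)) := by
  refine ⟨layeredSet A a s z, zero_mem_layeredSet A a s hz0, ?_, rfl⟩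
  exact cake_separated a hadm.1 A s z fun m => (hadm.2.2.2 m).1

/-- **Root layer cake.** For admissible data with `z 0 = 0`, twice the root energy of the counting
measure of the layered set is the in-layer energy plus the sum of the interactions with the other
layers: `2·h = Φ₀(a) + Σ'_m (if m = 0 then 0 else Φ(z m, L m))`. [folklore] -/
theorem two_mul_rootEnergy_eq {A : E3 →ₗᵢ[ℝ] E3} {a : ℝ} {s : ℤ → ℤ} {z : ℤ → ℝ}
    (hadm : IsAdmissibleLayering a s z) (hz0 : z 0 = 0) :
    2 * rootEnergy lennardJones ((Measure.count : Measure E3).restrict (layeredSet A a s z)) =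
      inLayerInteraction lennardJones a + ∑' m : ℤ, if m = 0 then (0 : ℝ) else
        layerInteraction lennardJones a (z m) (haggLabel s m) 1 := by
  have ha : 47 / 50 ≤ a := hadm.1
  have ha1 : a ≤ 1 := hadm.2.1
  have hz' : ∀ m : ℤ, 39 / 50 * a ≤ z (m + 1) - z m := fun m => (hadm.2.2.2 m).1
  set L := layeredSet A a s z with hL
  have hhc : IsRootedHardCore (1 / 2) ((Measure.count : Measure E3).restrict L) :=
    isRootedHardCore_layeredSet hadm hz0
  -- the Bochner integral against the counting measure is the `tsum` over the set
  have hint : Integrable (fun y : E3 => lennardJones ‖y‖) ((Measure.count : Measure E3).restrict L) :=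
    integrable_of_lintegral_ofReal_ne_top (measurable_lennardJones.comp measurable_norm)
      (lintegral_pos_ne_top_of_hc (by norm_num) hhc)
      (((lintegral_neg_le_of_hc (by norm_num) hhc).trans_lt ENNReal.ofReal_lt_top).ne)
  have h1 : ∫ y, lennardJones ‖y‖ ∂((Measure.count : Measure E3).restrict L) =
      ∑' y : L, lennardJones ‖(y : E3)‖ := by
    have hint' : IntegrableOn (fun y : E3 => lennardJones ‖y‖) L (Measure.count : Measure E3) := hint
    rw [setIntegral_countable _ (layeredSet_countable A a s z) hint']
    refine tsum_congr fun y => ?_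
    rw [Measure.real, Measure.count_singleton, ENNReal.toReal_one, one_smul]
  -- the root's own term vanishes
  have h2 : ∑' y : L, lennardJones ‖(y : E3)‖ =
      ∑' q : {q : E3 // q ∈ L ∧ q ≠ 0}, lennardJones (dist (0 : E3) q) := by
    rw [cake_tsum_subtype_ne_eq (fun q => lennardJones (dist (0 : E3) q)) L 0
      (by rw [dist_self, lennardJones_zero])]
    exact tsum_congr fun y => by rw [dist_zero_left]
  -- the layer cake at the root `(0,0,0)`
  have hc := cake_siteEnergy a ha ha1 A s z hz' 0 0 0
  have hp0 : A ((((0 : ℤ) : ℝ) • triangularVec₁ a) + (((0 : ℤ) : ℝ) • triangularVec₂ a) +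
      ((haggLabel s 0 : ℝ) • barlowOffset a) + (z 0 • layerNormal 1)) = 0 := by
    simp [hz0]
  rw [hp0] at hc
  simp only [haggLabel_zero, hz0, sub_zero] at hc
  rw [rootEnergy_def, mul_div_cancel₀ _ (two_ne_zero), h1, h2]
  exact hc

/-! ## The fault price at the root -/

/-- **Fault price at the root** (registered sub-goal `lms_fault_price_root`).  There is `c₀ > 0` (the
certified registry corner gap of `LayeredHull.stub_registry`) such that for all admissible data with
`z 0 = 0`, restacking the word to the alternating one at the same heights lowers twice the root energy
by at least `c₀` when the root layer is a stacking fault (`s 1 ≠ −s 0`), and never raises it.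
[folklore] -/
theorem lms_fault_price_root : ∃ c₀ : ℝ, 0 < c₀ ∧ ∀ (A : E3 →ₗᵢ[ℝ] E3) (a : ℝ) (s : ℤ → ℤ) (z : ℤ → ℝ), IsAdmissibleLayering a s z → z 0 = 0 → c₀ * (if s 1 = -s 0 then (0 : ℝ) else 1) ≤ 2 * rootEnergy lennardJones ((Measure.count : Measure E3).restrict (layeredSet A a s z)) - 2 * rootEnergy lennardJones ((Measure.count : Measure E3).restrict (layeredSet A a alternatingHagg z)) := by
  obtain ⟨c₀, hc₀, hreg⟩ := stub_registry
  refine ⟨c₀, hc₀, fun A a s z hadm hz0 => ?_⟩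
  obtain ⟨ha, ha1, hs, hz⟩ := hadm
  have hadm' : IsAdmissibleLayering a alternatingHagg z := ⟨ha, ha1, isHaggSeq_alternating, hz⟩
  have hz' : ∀ m : ℤ, 39 / 50 * a ≤ z (m + 1) - z m := fun m => (hz m).1
  obtain ⟨hreg1, hreg2⟩ := hreg a ha ha1
  have hp := clo_layer_price ha hs hz (C := 192) (c₀ := c₀)
    (fun H δ hH => cake_abs_layerInteraction_le a H ha ha1 hH δ) hreg1 hreg2 0
    (cake_summable_layers a ha ha1 s z hz' 0) (cake_summable_layers a ha ha1 alternatingHagg z hz' 0)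
  simp only [haggLabel_zero, hz0, sub_zero, zero_add] at hp
  rw [two_mul_rootEnergy_eq ⟨ha, ha1, hs, hz⟩ hz0, two_mul_rootEnergy_eq hadm' hz0]
  linarith

end Summit.AtomisticToContinuum.Crystallization.Theorems.SlackRigidityPricedFloorsRootCake

end
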